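import Literature.MathematicalPhysics.QuantumFieldTheory.Balaban1983to89.B11Eq98W80BackgroundModulus
import Literature.MathematicalPhysics.QuantumFieldTheory.Balaban1983to89.B11Eq78QuadLetterModulus
import Literature.MathematicalPhysics.QuantumFieldTheory.Balaban1983to89.B11Eq120SolutionContinuity

/-!
# `Balaban1983to89.B11Eq98W80ModulusLetterDefects` — T. Bałaban, *The variational problem and background fields in renormalization group method for lattice gauge theories*, Commun. Math. Phys. **102** (1985) 277–309 [Balaban1985Variational]: Prop. 4 (97)–(98) p. 292–293, Sect. C (44)–(52) p. 285, Prop. 6 (117)–(121) p. 295, with [Balaban1985BackgroundPropagators] Thm 3.4 p. 400 — THE BACKGROUND MODULUS OF `W = (δ/δA′)V` ACROSS TWO CARRIERS MODULO THE LETTER DEFECTS `δ_H` OF `H`, `δ_C` OF `C`, `δ_Δ` OF `Δ_π` AND THE V₀-GROUP's `δ_V` ONLY: the Sect. C map's modulus `δ_T` and the quadratic letter's `δ_Q` DISCHARGED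

statement-level skeleton of published theorems with citation tags; proofs where landed; nothing here is a claim about the Yang–Mills mass gap

PDF held: `paper:balaban1985-cmp102-variational-background` (journal page = PDF page + 276); pp. 285, 290–295 read on the text layer by this lineage.

CITATION HEADER (lean-in-tree rule 2026-08-18).  WHAT IS REPRODUCED: nothing of print is asserted.  This is the junction file of three landed pieces:
this lineage's `B11Eq98W80BackgroundModulus.exists_W80_background_modulus` (the W80 modulus modulo δ_T, δ_Q, δ_Δ, δ_V), its `B11Eq78QuadLetterModulus`
(δ_Q from δ_H, δ_C by Cauchy on the second Fréchet derivative), and the NE9 row OWNER's `B11Eq120SolutionContinuity.norm_map_sectC_sub_le` (δ_T from δ_H, δ_C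
by the contraction-mapping perturbation of Prop. 6 (117)–(121)).  Its consumer is the OWNER's announced `Support/NE9CurChartLipschitzAtFlatW80` ((Z)
`NE9CurChartLipschitzAtFlat` composed with the W80 modulus; journal [NE9P1-G83-ONLINE] INTENT-2), where `δ_H`, `δ_C` are PRODUCED at the flat point
(`B11Eq117LetterDefects.exists_letter_defects_at_flat`, `B11Eq44COperatorModulus.exists_Cc_modulus_at_flat`) and between two backgrounds by ne9-leaf-04's
`B11Eq117LetterDefectsTwoBackgrounds` ∕ `B11Eq44COperatorTwoBackgrounds.sectC_modulus_twoBackgrounds`.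

WHAT IS PROVED (sorry-free; axioms standard; 0 def).  **`exists_W80_background_modulus_of_letter_defects`**: with the scalar letters and `K > 0` of
`exists_W80_background_modulus` (chosen BEFORE the carriers and the operator letters), for every radius `r` under the two caps, every pair of carriers
and Sect. C regimes, all letters in their bounds, every Sect. C perturbation radius `ρ_C, s_C` with `K_ι(ε_C + a_C) ≤ ρ_C`, `0 < s_C`, `2(ρ_C + s_C) ≤ c₄`,
`4bC₂(ρ_C + s_C) < 1` (the OWNER's (B) §4 letters), and DISPLAYED `δ_H` (`‖ι(H₁B) − H₂B‖ ≤ δ_H‖B‖`), `δ_C` (`‖C₁y − C₂(ιy)‖ ≤ δ_C` on `‖y‖ < ε_C + a_C`),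
`δ_Δ`, `δ_V`:  **`∀ P, ‖P‖ < r → ‖W80(…₁)(P) − W80(…₂)(ιP)‖₍₋₃₎ ≤ K·(δ_T + δ_Q + δ_Δ + δ_V)`** with the EXPLICIT
`δ_T = (δ_H·C₂(ε_C + a_C)² + b·δ_C)∕(1 − 4bC₂(ρ_C + s_C))` and `δ_Q = (8C₂δ_H + 8bδ_C∕(ε_C + a_C)²)·a_C²` — linear in `δ_H`, `δ_C`.

HONEST SCOPE — what is NOT claimed.  (i) Composition BY NAME; crude finite-lattice constants; nothing of Prop. 4 ∕ (98) ∕ Prop. 6 ∕ Thm 3.4 proved.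
(ii) `δ_H, δ_C, δ_Δ, δ_V` displayed (δ_V = the V₀-group's modulus, a ONE-carrier statement by `B11Eq80CurrentTwoCarriers.curV0_jetId` — this lineage's
next line; δ_Δ the `Δ_π` letter's).  (iii) NOT summit progress (cell pub-balaban: NE9 NOT PRINTED ∕ NOT PROVED; «NE9 ⇐ the named binders»; spine PROVED
0/9; HONEST DEPENDENCY: continuum YM on T⁴ ⇐ BetaPertH ∧ nine spine estimates (0/9 proved); BetaPertH ⇐ (D1) ∧ (D4) ∧ CAP+tail; G-an2-4 gates asym,
D1 and NE2/3/4).  Unit `b2b-balaban-t4-ne9-formalise-leaf-05` (NE9 crux-team leaf prover, gen 70).  Imports the three files named ONLY; modifies nothing.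
-/

noncomputable section

open Metric Set Filter Topology

namespace Literature.MathematicalPhysics.QuantumFieldTheory.Balaban1983to89.B11Eq98W80ModulusLetterDefects

open Literature.MathematicalPhysics.QuantumFieldTheory.Balaban1983to89.B11Prop6Scheme (Prop4Hyp)
open Literature.MathematicalPhysics.QuantumFieldTheory.Balaban1983to89.B11Eq174Chart (solA Regime)
open Literature.MathematicalPhysics.QuantumFieldTheory.Balaban1983to89.B11Eq63V0GroupCurrent (curV0)
open Literature.MathematicalPhysics.QuantumFieldTheory.Balaban1983to89.B11Eq80Current (quadPart W80)
open Literature.MathematicalPhysics.QuantumFieldTheory.Balaban1983to89.B11Eq111FrakG (jetLinearEquiv)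
open Literature.MathematicalPhysics.QuantumFieldTheory.Balaban1983to89.B11Eq98W80BackgroundModulus (exists_W80_background_modulus)
open Literature.MathematicalPhysics.QuantumFieldTheory.Balaban1983to89.B11Eq78QuadLetterModulus (quadLetter_modulus_on_ball)
open Literature.MathematicalPhysics.QuantumFieldTheory.Balaban1983to89.B11Eq120SolutionContinuity (norm_map_sectC_sub_le)
open B9SectCLatticeCarrier (Bond)
open B11Eq115Space

variable {𝔸 : Type*} [NormedRing 𝔸] [NormedAlgebra ℂ 𝔸] [FiniteDimensional ℂ 𝔸]
variable {d : ℕ} {Pd : Fin d → ℕ} {L η : ℝ} [Fact (0 < L)] [Fact (0 < η)] {lev₀ : Bond d Pd → ℕ} {κ' : Type*} [Fintype κ']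
  {lev₁ : κ' → ℕ}
variable {𝒳 : Type*} [NormedAddCommGroup 𝒳] [NormedSpace ℂ 𝒳]

/-- **THE W80 BACKGROUND MODULUS MODULO `δ_H, δ_C, δ_Δ, δ_V`** — see the module header: `exists_W80_background_modulus` with `δ_T` supplied by
`B11Eq120SolutionContinuity.norm_map_sectC_sub_le` (at `y := ιx`) and `δ_Q` by `B11Eq78QuadLetterModulus.quadLetter_modulus_on_ball`, both written out as
linear expressions in `δ_H, δ_C`. [folklore]
[cite: Balaban1985Variational, Prop. 4 (97)–(98) pp.292–293, (47)–(52) p.285, Prop. 6 (117)–(121) p.295; Balaban1985BackgroundPropagators, Thm 3.4 p.400] -/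
theorem exists_W80_background_modulus_of_letter_defects [CompleteSpace 𝒳] [CompleteSpace 𝔸] {b C₂ c₄ aC εC CV RV Mρ Mτ MJ MΔ MD Kι : ℝ}
    (haC : 0 < aC) (hεC : 0 ≤ εC) (hcontr : 4 * b * C₂ * (εC + aC) < 1) (hCV : 0 ≤ CV) (hRV : 0 < RV) (hMρ : 0 ≤ Mρ) (hMτ : 0 ≤ Mτ)
    (hMJ : 0 ≤ MJ) (hMΔ : 0 ≤ MΔ) (hMD : 0 ≤ MD) (hKι : 1 ≤ Kι) :
    ∃ K : ℝ, 0 < K ∧ ∀ {r : ℝ}, r ≤ aC / (2 * Kι ^ 2) → r ≤ RV / (4 * Kι * (1 / (1 - 4 * b * C₂ * (εC + aC)))) →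
      ∀ {Dc₁ Dc₂ : (Bond d Pd → 𝔸) →ₗ[ℂ] (κ' → 𝔸)}, (∀ g : Bond d Pd → 𝔸, ‖Dc₂ g‖ ≤ MD * ‖g‖) →
      (∀ P : Space115 L η lev₀ lev₁ Dc₁, ‖(LinearMap.toContinuousLinearMap ((jetLinearEquiv L η lev₀ lev₁ Dc₂).symm.toLinearMap ∘ₗ (jetLinearEquiv L η lev₀ lev₁ Dc₁).toLinearMap)) P‖ ≤ Kι * ‖P‖) → (∀ Q : Space115 L η lev₀ lev₁ Dc₂, ‖(LinearMap.toContinuousLinearMap ((jetLinearEquiv L η lev₀ lev₁ Dc₁).symm.toLinearMap ∘ₗ (jetLinearEquiv L η lev₀ lev₁ Dc₂).toLinearMap)) Q‖ ≤ Kι * ‖Q‖) →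
      ∀ {H₁ : 𝒳 →L[ℂ] Space115 L η lev₀ lev₁ Dc₁} {C₁ : Space115 L η lev₀ lev₁ Dc₁ → 𝒳}
        {H₂ : 𝒳 →L[ℂ] Space115 L η lev₀ lev₁ Dc₂} {C₂' : Space115 L η lev₀ lev₁ Dc₂ → 𝒳},
        Regime H₁ 0 C₁ b 0 C₂ c₄ 0 aC εC → Prop4Hyp C₁ C₂ c₄ → Regime H₂ 0 C₂' b 0 C₂ c₄ 0 aC εC → Prop4Hyp C₂' C₂ c₄ →
      ∀ (ρ : (𝔸 →L[ℂ] ℂ) →L[ℂ] 𝔸) (τ : 𝔸 →L[ℂ] ℂ) (U₁ U₂ : Bond d Pd → 𝔸ˣ), ‖ρ‖ ≤ Mρ → ‖τ‖ ≤ Mτ →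
        (∀ Y : Space115 L η lev₀ lev₁ Dc₁, ‖Y‖ < RV → ‖curV0 (lev₁ := lev₁) (Dc := Dc₁) ρ τ U₁ Y‖ ≤ CV * ‖Y‖ ^ 2) →
        (∀ Y : Space115 L η lev₀ lev₁ Dc₂, ‖Y‖ < RV → ‖curV0 (lev₁ := lev₁) (Dc := Dc₂) ρ τ U₂ Y‖ ≤ CV * ‖Y‖ ^ 2) →
      ∀ (J : NegSize L η lev₀ 3 𝔸) (Δπ₁ : Space115 L η lev₀ lev₁ Dc₁ →L[ℂ] NegSize L η lev₀ 3 𝔸)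
        (Δπ₂ : Space115 L η lev₀ lev₁ Dc₂ →L[ℂ] NegSize L η lev₀ 3 𝔸), ‖J‖ ≤ MJ → ‖Δπ₁‖ ≤ MΔ → ‖Δπ₂‖ ≤ MΔ →
      ∀ {ρC sC : ℝ}, Kι * (εC + aC) ≤ ρC → 0 < sC → 2 * (ρC + sC) ≤ c₄ → 4 * b * C₂ * (ρC + sC) < 1 →
      ∀ {δH δC δΔ δV : ℝ}, 0 ≤ δH → 0 ≤ δC → 0 ≤ δΔ → 0 ≤ δV →
        (∀ B : 𝒳, ‖(LinearMap.toContinuousLinearMap ((jetLinearEquiv L η lev₀ lev₁ Dc₂).symm.toLinearMap ∘ₗ (jetLinearEquiv L η lev₀ lev₁ Dc₁).toLinearMap)) (H₁ B) - H₂ B‖ ≤ δH * ‖B‖) →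
        (∀ y : Space115 L η lev₀ lev₁ Dc₁, ‖y‖ < εC + aC → ‖C₁ y - C₂' ((LinearMap.toContinuousLinearMap ((jetLinearEquiv L η lev₀ lev₁ Dc₂).symm.toLinearMap ∘ₗ (jetLinearEquiv L η lev₀ lev₁ Dc₁).toLinearMap)) y)‖ ≤ δC) →
        (∀ Y : Space115 L η lev₀ lev₁ Dc₁, ‖Δπ₁ Y - Δπ₂ ((LinearMap.toContinuousLinearMap ((jetLinearEquiv L η lev₀ lev₁ Dc₂).symm.toLinearMap ∘ₗ (jetLinearEquiv L η lev₀ lev₁ Dc₁).toLinearMap)) Y)‖ ≤ δΔ * ‖Y‖) →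
        (∀ Y : Space115 L η lev₀ lev₁ Dc₁, ‖Y‖ < RV →
          ‖curV0 (lev₁ := lev₁) (Dc := Dc₁) ρ τ U₁ Y - curV0 (lev₁ := lev₁) (Dc := Dc₂) ρ τ U₂ ((LinearMap.toContinuousLinearMap ((jetLinearEquiv L η lev₀ lev₁ Dc₂).symm.toLinearMap ∘ₗ (jetLinearEquiv L η lev₀ lev₁ Dc₁).toLinearMap)) Y)‖ ≤ δV) →
      ∀ P : Space115 L η lev₀ lev₁ Dc₁, ‖P‖ < r →
        ‖W80 ρ τ U₁ H₁ C₁ εC J Δπ₁ P - W80 ρ τ U₂ H₂ C₂' εC J Δπ₂ ((LinearMap.toContinuousLinearMap ((jetLinearEquiv L η lev₀ lev₁ Dc₂).symm.toLinearMap ∘ₗ (jetLinearEquiv L η lev₀ lev₁ Dc₁).toLinearMap)) P)‖ ≤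
          K * ((δH * (C₂ * (εC + aC) ^ 2) + b * δC) / (1 - 4 * b * C₂ * (ρC + sC)) +
            (8 * C₂ * δH + 8 * b * δC / (εC + aC) ^ 2) * aC ^ 2 + δΔ + δV) := by
  obtain ⟨K, hK, HW⟩ := exists_W80_background_modulus (d := d) (Pd := Pd) (L := L) (η := η) (lev₀ := lev₀) (κ' := κ') (lev₁ := lev₁) (𝒳 := 𝒳)
    (𝔸 := 𝔸) haC hεC hcontr hCV hRV hMρ hMτ hMJ hMΔ hMD hKι
  refine ⟨K, hK, ?_⟩
  intro r hra hrV Dc₁ Dc₂ hD₂ hι hκι H₁ C₁ H₂ C₂' RC₁ hC₁ RC₂ hC₂ ρ τ U₁ U₂ hρ hτ hqV₁ hqV₂ J Δπ₁ Δπ₂ hJ hΔ₁ hΔ₂ ρC sC hρ₁ hsC hdomC hκC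
    δH δC δΔ δV hδH hδC hδΔ hδV hdH hdC hmΔ hmV P hP
  have hKι0 : 0 < Kι := lt_of_lt_of_le one_pos hKι
  have hs : 0 < εC + aC := by linarith
  have hb0 : 0 ≤ b := RC₁.B₀_nonneg
  have hC₂0 : 0 ≤ C₂ := RC₁.C₄_nonneg
  have hρ₂ : εC + aC ≤ ρC := (le_mul_of_one_le_left hs.le hKι).trans hρ₁
  have hden : 0 < 1 - 4 * b * C₂ * (ρC + sC) := by linarith
  have hc₄ : 0 < c₄ := by linarith [RC₁.dom]
  have hsc : εC + aC ≤ c₄ := by linarith [RC₁.dom, RC₁.ε₄_nonneg]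
  have hKs : Kι * (εC + aC) ≤ c₄ := by linarith
  have hH₂ : ‖H₂‖ ≤ b := ContinuousLinearMap.opNorm_le_bound _ RC₂.B₀_nonneg RC₂.norm_G
  -- δ_T from the Sect. C map across the carriers ((B) §4 at `y := ιx`)
  have hT : ∀ x : Space115 L η lev₀ lev₁ Dc₁, ‖x‖ < aC → ‖(LinearMap.toContinuousLinearMap ((jetLinearEquiv L η lev₀ lev₁ Dc₂).symm.toLinearMap ∘ₗ (jetLinearEquiv L η lev₀ lev₁ Dc₁).toLinearMap)) x‖ < aC →
      ‖(LinearMap.toContinuousLinearMap ((jetLinearEquiv L η lev₀ lev₁ Dc₂).symm.toLinearMap ∘ₗ (jetLinearEquiv L η lev₀ lev₁ Dc₁).toLinearMap)) (x + solA H₁ 0 C₁ 0 εC x) - ((LinearMap.toContinuousLinearMap ((jetLinearEquiv L η lev₀ lev₁ Dc₂).symm.toLinearMap ∘ₗ (jetLinearEquiv L η lev₀ lev₁ Dc₁).toLinearMap)) x + solA H₂ 0 C₂' 0 εC ((LinearMap.toContinuousLinearMap ((jetLinearEquiv L η lev₀ lev₁ Dc₂).symm.toLinearMap ∘ₗ (jetLinearEquiv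 L η lev₀ lev₁ Dc₁).toLinearMap)) x))‖ ≤
        (δH * (C₂ * (εC + aC) ^ 2) + b * δC) / (1 - 4 * b * C₂ * (ρC + sC)) := fun x hx hιx => by
    have h := norm_map_sectC_sub_le RC₁ RC₂ hx hιx hKι0.le hι hδH hdH hdC hρ₁ hρ₂ hsC hdomC hκC
    rwa [sub_self, norm_zero, zero_div, zero_add] at h
  -- δ_Q from δ_H, δ_C by Cauchy (this lineage's `B11Eq78QuadLetterModulus`)
  have hQ : ∀ x : Space115 L η lev₀ lev₁ Dc₁, ‖x‖ < aC → ‖(LinearMap.toContinuousLinearMap ((jetLinearEquiv L η lev₀ lev₁ Dc₂).symm.toLinearMap ∘ₗ (jetLinearEquiv L η lev₀ lev₁ Dc₁).toLinearMap)) x‖ < aC →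
      ‖(LinearMap.toContinuousLinearMap ((jetLinearEquiv L η lev₀ lev₁ Dc₂).symm.toLinearMap ∘ₗ (jetLinearEquiv L η lev₀ lev₁ Dc₁).toLinearMap)) (H₁ (quadPart C₁ x)) - H₂ (quadPart C₂' ((LinearMap.toContinuousLinearMap ((jetLinearEquiv L η lev₀ lev₁ Dc₂).symm.toLinearMap ∘ₗ (jetLinearEquiv L η lev₀ lev₁ Dc₁).toLinearMap)) x))‖ ≤ (8 * C₂ * δH + 8 * b * δC / (εC + aC) ^ 2) * aC ^ 2 :=
    fun x hx _ => quadLetter_modulus_on_ball hc₄ hs hsc hKι0 hKs hC₂0 hδC hC₁.differentiableOn hC₂.differentiableOn hC₁.quad hι hH₂ hδH hdH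
      hdC x hx
  have hδT0 : 0 ≤ (δH * (C₂ * (εC + aC) ^ 2) + b * δC) / (1 - 4 * b * C₂ * (ρC + sC)) := div_nonneg (by positivity) hden.le
  have hδQ0 : 0 ≤ (8 * C₂ * δH + 8 * b * δC / (εC + aC) ^ 2) * aC ^ 2 := by positivity
  exact HW hra hrV hD₂ hι hκι RC₁ hC₁ RC₂ hC₂ ρ τ U₁ U₂ hρ hτ hqV₁ hqV₂ J Δπ₁ Δπ₂ hJ hΔ₁ hΔ₂ hδT0 hδQ0 hδΔ hδV hT hQ hmΔ hmV P hP

end Literature.MathematicalPhysics.QuantumFieldTheory.Balaban1983to89.B11Eq98W80ModulusLetterDefects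

end
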